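import Summits.QuantumFields.GaugeBoot.BootstrapArchimedean
import HarnessLib

/-!
# Completeness of SOS ⊕ loop-equation certificates for the word-truncated lattice bootstrap: no duality gap (gauge-boot, L1/L4 supplement)

HONEST FRAMING (cell `pub-gaugeboot`, page 1 of every file): the venture produces certified bounds
on lattice expectations at stated coupling, gauge group, dimension and torus size; NOT a mass gap,
NOT a continuum limit, NOT a string tension; NOT Yang–Mills-summit-bearing (barriers
`FixedCouplingUltralocality`, `PerturbativeInvisibility`). Structural; it certifies no number.

## Content (any lattice `ι`, any compact `G`, any unitary `r`, any local actions with polynomial shift derivatives)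

Level `n` of the word-length truncation: unknowns = the values a linear functional `φ` gives to
observables; constraints (`IsBootstrapFeasible r k S β (wordTruncation r n) φ`) = `φ 1 = 1`,
`φ (v v) ≥ 0` for test functions `v` of word length `≤ n` (ONE PSD moment matrix), and the loop
equations `φ f' = β φ (f S_i')` for test functions `f` of length `≤ n`. A CERTIFICATE for `P ≤ c`
is an identity `c • 1 - P = Σ_j v_j² + Σ_l λ_l (f_l' - β f_l S_l')` — membership of `c • 1 - P` in
`certCone r k S β (wordTruncation r n)`. Assume some functional is feasible (on a torus: Wilson's).

* ★★★ `forall_feasible_apply_le_iff` — NO DUALITY GAP: for every objective `P` in the certificate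
  domain (linear combinations of words of length `≤ 2n` and rows — everything level `n` can bound),
  `φ P ≤ c` for EVERY level-`n` feasible `φ` iff `(c + ε) • 1 - P ∈ certCone` for every `ε > 0`;
  ★★★ `exists_certificate_of_forall_apply_le` — so every constant strictly above the level-`n` SDP
  maximum of `P` HAS an SOS ⊕ rows certificate `c' • 1 - P = σ + ρ`, `σ` a non-negative combination
  of squares of level-`n` test functions, `ρ` a combination of level-`n` row elements; the lower
  twins `forall_feasible_le_apply_iff`, `exists_certificate_of_forall_le_apply`.
* ★★ `exists_feasible_isMax` / `exists_feasible_isMin` — the SDP maximum and minimum are ATTAINED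
  (Riesz extension — no compactness argument); `feasible_convex` — feasibility is convex; hence
  ★★ `exists_values_eq_Icc` — the set of level-`n` feasible values of `P` is a compact interval
  `[lo, hi]`, and ★★ `sSup_values_eq_sInf_certified` — `hi = inf {c | c • 1 - P ∈ certCone}`.

Mechanism: `OrderUnitDuality` (M. Riesz extension) + `BootstrapArchimedean` (`1` is an order unit
for the certificate cone on the certificate domain, by unitarity) +
`isBootstrapFeasible_iff_isDualFeasible`.

References: C. Josz, D. Henrion, Optim. Lett. 10 (2016) 3 (no gap in Lasserre's hierarchy with a
ball constraint); M. Laurent, IMA Vol. 149 (2009) Thm 6.1; Anderson–Kruczenski (2017),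
Kazakov–Zheng (2022, 2024) for the lattice bootstrap SDPs themselves. Folklore.
-/

noncomputable section

open Literature.MathematicalPhysics.QuantumFieldTheory (LatticeRep)

namespace Summit.QuantumFields.GaugeBoot

open OrderUnitDuality

section General

variable {ι : Type*} [DecidableEq ι] {G : Type*} [Group G] [TopologicalSpace G] (r : LatticeRep G)
  {K : Type*} {k : K → ℝ → G} {S : ι → (ι → G) → ℝ} {β : ℝ}

/-- ★ **Feasibility is convex**: a convex combination of two level-`V` feasible functionals is
feasible. [folklore] -/
theorem feasible_convex {V : Set C(ι → G, ℝ)} {φ ψ : C(ι → G, ℝ) →ₗ[ℝ] ℝ}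
    (hφ : IsBootstrapFeasible r k S β V φ) (hψ : IsBootstrapFeasible r k S β V ψ) {a b : ℝ}
    (ha : 0 ≤ a) (hb : 0 ≤ b) (hab : a + b = 1) : IsBootstrapFeasible r k S β V (a • φ + b • ψ) := by
  refine ⟨?_, fun v hv => ?_, fun i c => ?_⟩
  · simp only [LinearMap.add_apply, LinearMap.smul_apply, hφ.1, hψ.1, smul_eq_mul, mul_one, hab]
  · simp only [LinearMap.add_apply, LinearMap.smul_apply, smul_eq_mul]
    exact add_nonneg (mul_nonneg ha (hφ.2.1 v hv)) (mul_nonneg hb (hψ.2.1 v hv))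
  · obtain ⟨S₁, hS₁m, hS₁d, hrows₁⟩ := hφ.2.2 i c
    obtain ⟨S₂, -, hS₂d, hrows₂⟩ := hψ.2.2 i c
    have he : S₂ = S₁ := ContinuousMap.ext fun U => (hS₂d U).unique (hS₁d U)
    refine ⟨S₁, hS₁m, hS₁d, fun f hf f' hf' hf'd => ?_⟩
    simp only [LinearMap.add_apply, LinearMap.smul_apply, smul_eq_mul, hrows₁ f hf f' hf' hf'd,
      hrows₂ f hf f' hf' hf'd, he]
    ring

omit [DecidableEq ι] [Group G] in
/-- **SOS elements are finite sums of squares**: an element of the SOS cone of a test set closed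
under scalars is `Σ_j v_j v_j` for a finite list of test functions (absorb the non-negative
coefficients as square roots). [folklore] -/
theorem exists_list_of_mem_sosCone {V : Set C(ι → G, ℝ)} (hV : ∀ (c : ℝ) (v : C(ι → G, ℝ)), v ∈ V → c • v ∈ V)
    {x : C(ι → G, ℝ)} (hx : x ∈ sosCone V) :
    ∃ l : List C(ι → G, ℝ), (∀ v ∈ l, v ∈ V) ∧ (l.map fun v => v * v).sum = x := by
  induction hx using Submodule.span_induction with
  | mem y hy =>
    obtain ⟨v, hv, rfl⟩ := hy
    exact ⟨[v], by simpa using hv, by simp⟩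
  | zero => exact ⟨[], by simp, by simp⟩
  | add x y _ _ hx hy =>
    obtain ⟨l₁, hl₁, rfl⟩ := hx
    obtain ⟨l₂, hl₂, rfl⟩ := hy
    refine ⟨l₁ ++ l₂, fun v hv => ?_, by rw [List.map_append, List.sum_append]⟩
    rcases List.mem_append.1 hv with hv | hv
    · exact hl₁ v hv
    · exact hl₂ v hv
  | smul c x _ hx =>
    obtain ⟨l, hl, rfl⟩ := hx
    refine ⟨l.map fun v => Real.sqrt c • v, fun v hv => ?_, ?_⟩
    · obtain ⟨w, hw, rfl⟩ := List.mem_map.1 hv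
      exact hV _ w (hl w hw)
    · rw [show c • (l.map fun v => v * v).sum = (c : ℝ) • (l.map fun v => v * v).sum from rfl,
        List.smul_sum, List.map_map, List.map_map]
      congr 1
      refine List.map_congr_left fun v _ => ?_
      simp only [Function.comp_apply, smul_mul_smul_comm, Real.mul_self_sqrt c.2]

omit [DecidableEq ι] in
/-- The word truncation is closed under scalars. -/
theorem smul_mem_wordTruncation {n : ℕ} (c : ℝ) {v : C(ι → G, ℝ)}
    (hv : v ∈ wordTruncation (ι := ι) r n) : c • v ∈ wordTruncation (ι := ι) r n :=
  (Submodule.span ℝ _).smul_mem c hv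

variable (k S β) in
/-- **The set of level-`n` feasible values of an objective `P`** (the interval an SDP at word
level `n` bounds from both sides; `levelValuesSuN` is its `SU(N)`-torus instance). [folklore] -/
def feasibleValues (n : ℕ) (P : C(ι → G, ℝ)) : Set ℝ :=
  {t | ∃ φ : C(ι → G, ℝ) →ₗ[ℝ] ℝ,
    IsBootstrapFeasible r k S β (wordTruncation (ι := ι) r n) φ ∧ φ P = t}

/-- Membership in `feasibleValues`, unfolded. -/
theorem mem_feasibleValues_iff {n : ℕ} {P : C(ι → G, ℝ)} {t : ℝ} :
    t ∈ feasibleValues r k S β n P ↔ ∃ φ : C(ι → G, ℝ) →ₗ[ℝ] ℝ,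
      IsBootstrapFeasible r k S β (wordTruncation (ι := ι) r n) φ ∧ φ P = t :=
  Iff.rfl

/-- Under polynomial derivatives of the local actions, level-`n` feasibility is dual feasibility
for the level-`n` certificate cone, as sets of functionals. -/
theorem isDualFeasible_iff_feasible
    (hS : ∀ (i : ι) (a : K), ∃ S' ∈ polyAlgebra (ι := ι) r,
      ∀ U, HasDerivAt (fun t => S i (Function.update U i (k a t * U i))) (S' U) 0)
    {n : ℕ} {φ : C(ι → G, ℝ) →ₗ[ℝ] ℝ} :
    IsDualFeasible (certCone r k S β (wordTruncation (ι := ι) r n)) 1 φ ↔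
      IsBootstrapFeasible r k S β (wordTruncation (ι := ι) r n) φ :=
  (isBootstrapFeasible_iff_isDualFeasible r hS).symm

/-! ## No duality gap -/

/-- ★★★ **No duality gap for the word-truncated lattice bootstrap.** Local actions with
polynomial shift derivatives, some level-`n` feasible functional exists, `P` in the level-`n`
certificate domain: `φ P ≤ c` for every level-`n` feasible `φ` if and only if, for every `ε > 0`,
`(c + ε) • 1 - P` is a non-negative combination of squares of level-`n` test functions plus a
combination of level-`n` Schwinger–Dyson row elements. [folklore] -/
theorem forall_feasible_apply_le_iff
    (hS : ∀ (i : ι) (a : K), ∃ S' ∈ polyAlgebra (ι := ι) r,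
      ∀ U, HasDerivAt (fun t => S i (Function.update U i (k a t * U i))) (S' U) 0)
    {n : ℕ} (h0 : ∃ φ₀, IsBootstrapFeasible r k S β (wordTruncation (ι := ι) r n) φ₀)
    {P : C(ι → G, ℝ)} (hP : P ∈ certDomain r k S β n) {c : ℝ} :
    (∀ φ : C(ι → G, ℝ) →ₗ[ℝ] ℝ, IsBootstrapFeasible r k S β (wordTruncation (ι := ι) r n) φ →
      φ P ≤ c) ↔
      ∀ ε : ℝ, 0 < ε → (c + ε) • (1 : C(ι → G, ℝ)) - P ∈
        certCone r k S β (wordTruncation (ι := ι) r n) := by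
  obtain ⟨hKE, h1, hE⟩ := certCone_orderUnit r (k := k) (S := S) (β := β) n
  have h0' : ∃ φ₀, IsDualFeasible (certCone r k S β (wordTruncation (ι := ι) r n)) 1 φ₀ := by
    obtain ⟨φ₀, hφ₀⟩ := h0; exact ⟨φ₀, hφ₀.isDualFeasible r⟩
  rw [← OrderUnitDuality.forall_apply_le_iff (certDomain r k S β n) hKE h1 hE h0' hP]
  simp only [isDualFeasible_iff_feasible r hS]

/-- ★★★ **Every constant strictly above the SDP maximum has an SOS ⊕ rows certificate.** If
`φ P ≤ c` for every level-`n` feasible `φ` and `c < c'`, then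
`c' • 1 - P = σ + ρ` with `σ ∈ sosCone (wordTruncation r n)` (a non-negative combination of
squares of level-`n` test functions) and `ρ ∈ rowSpace` (a linear combination of level-`n`
row elements `f' - β f S'`). [folklore] -/
theorem exists_certificate_of_forall_apply_le
    (hS : ∀ (i : ι) (a : K), ∃ S' ∈ polyAlgebra (ι := ι) r,
      ∀ U, HasDerivAt (fun t => S i (Function.update U i (k a t * U i))) (S' U) 0)
    {n : ℕ} (h0 : ∃ φ₀, IsBootstrapFeasible r k S β (wordTruncation (ι := ι) r n) φ₀)
    {P : C(ι → G, ℝ)} (hP : P ∈ certDomain r k S β n) {c c' : ℝ}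
    (h : ∀ φ : C(ι → G, ℝ) →ₗ[ℝ] ℝ, IsBootstrapFeasible r k S β (wordTruncation (ι := ι) r n) φ →
      φ P ≤ c) (hc : c < c') :
    ∃ σ ∈ sosCone (wordTruncation (ι := ι) r n),
      ∃ ρ ∈ rowSpace r k S β (wordTruncation (ι := ι) r n), σ + ρ = c' • (1 : C(ι → G, ℝ)) - P := by
  have h' := (forall_feasible_apply_le_iff r hS h0 hP).1 h (c' - c) (sub_pos.2 hc)
  rw [add_sub_cancel] at h'
  exact (mem_certCone_iff r).1 h'

/-- ★★★ **The certificate, fully unpacked**: `c' • 1 - P = Σ_{v ∈ l} v v + ρ` for a finite list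
`l` of test functions of word length `≤ n` and a combination `ρ` of level-`n` row elements.
[folklore] -/
theorem exists_list_certificate_of_forall_apply_le
    (hS : ∀ (i : ι) (a : K), ∃ S' ∈ polyAlgebra (ι := ι) r,
      ∀ U, HasDerivAt (fun t => S i (Function.update U i (k a t * U i))) (S' U) 0)
    {n : ℕ} (h0 : ∃ φ₀, IsBootstrapFeasible r k S β (wordTruncation (ι := ι) r n) φ₀)
    {P : C(ι → G, ℝ)} (hP : P ∈ certDomain r k S β n) {c c' : ℝ}
    (h : ∀ φ : C(ι → G, ℝ) →ₗ[ℝ] ℝ, IsBootstrapFeasible r k S β (wordTruncation (ι := ι) r n) φ →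
      φ P ≤ c) (hc : c < c') :
    ∃ l : List C(ι → G, ℝ), (∀ v ∈ l, v ∈ wordTruncation (ι := ι) r n) ∧
      ∃ ρ ∈ rowSpace r k S β (wordTruncation (ι := ι) r n),
        (l.map fun v => v * v).sum + ρ = c' • (1 : C(ι → G, ℝ)) - P := by
  obtain ⟨σ, hσ, ρ, hρ, h⟩ := exists_certificate_of_forall_apply_le r hS h0 hP h hc
  obtain ⟨l, hl, rfl⟩ := exists_list_of_mem_sosCone (fun c v hv => smul_mem_wordTruncation r c hv) hσ
  exact ⟨l, hl, ρ, hρ, h⟩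

/-- ★★★ **No duality gap, lower bounds**: `c ≤ φ P` for every level-`n` feasible `φ` iff
`P - (c - ε) • 1 ∈ certCone` for every `ε > 0`. [folklore] -/
theorem forall_feasible_le_apply_iff
    (hS : ∀ (i : ι) (a : K), ∃ S' ∈ polyAlgebra (ι := ι) r,
      ∀ U, HasDerivAt (fun t => S i (Function.update U i (k a t * U i))) (S' U) 0)
    {n : ℕ} (h0 : ∃ φ₀, IsBootstrapFeasible r k S β (wordTruncation (ι := ι) r n) φ₀)
    {P : C(ι → G, ℝ)} (hP : P ∈ certDomain r k S β n) {c : ℝ} :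
    (∀ φ : C(ι → G, ℝ) →ₗ[ℝ] ℝ, IsBootstrapFeasible r k S β (wordTruncation (ι := ι) r n) φ →
      c ≤ φ P) ↔
      ∀ ε : ℝ, 0 < ε → P - (c - ε) • (1 : C(ι → G, ℝ)) ∈
        certCone r k S β (wordTruncation (ι := ι) r n) := by
  obtain ⟨hKE, h1, hE⟩ := certCone_orderUnit r (k := k) (S := S) (β := β) n
  have h0' : ∃ φ₀, IsDualFeasible (certCone r k S β (wordTruncation (ι := ι) r n)) 1 φ₀ := by
    obtain ⟨φ₀, hφ₀⟩ := h0; exact ⟨φ₀, hφ₀.isDualFeasible r⟩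
  rw [← OrderUnitDuality.forall_le_apply_iff (certDomain r k S β n) hKE h1 hE h0' hP]
  simp only [isDualFeasible_iff_feasible r hS]

/-- ★★★ **Every constant strictly below the SDP minimum has a certificate** `P - c' • 1 = σ + ρ`.
[folklore] -/
theorem exists_certificate_of_forall_le_apply
    (hS : ∀ (i : ι) (a : K), ∃ S' ∈ polyAlgebra (ι := ι) r,
      ∀ U, HasDerivAt (fun t => S i (Function.update U i (k a t * U i))) (S' U) 0)
    {n : ℕ} (h0 : ∃ φ₀, IsBootstrapFeasible r k S β (wordTruncation (ι := ι) r n) φ₀)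
    {P : C(ι → G, ℝ)} (hP : P ∈ certDomain r k S β n) {c c' : ℝ}
    (h : ∀ φ : C(ι → G, ℝ) →ₗ[ℝ] ℝ, IsBootstrapFeasible r k S β (wordTruncation (ι := ι) r n) φ →
      c ≤ φ P) (hc : c' < c) :
    ∃ σ ∈ sosCone (wordTruncation (ι := ι) r n),
      ∃ ρ ∈ rowSpace r k S β (wordTruncation (ι := ι) r n), σ + ρ = P - c' • (1 : C(ι → G, ℝ)) := by
  have h' := (forall_feasible_le_apply_iff r hS h0 hP).1 h (c - c') (sub_pos.2 hc)
  rw [sub_sub_cancel] at h'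
  exact (mem_certCone_iff r).1 h'

/-! ## The extrema are attained; the feasible values form a compact interval -/

/-- ★★ **The SDP maximum is attained**: some level-`n` feasible functional maximises `P`, and the
maximum is the order-unit gauge `inf {c | c • 1 - P ∈ certCone}`. [folklore] -/
theorem exists_feasible_isGreatest
    (hS : ∀ (i : ι) (a : K), ∃ S' ∈ polyAlgebra (ι := ι) r,
      ∀ U, HasDerivAt (fun t => S i (Function.update U i (k a t * U i))) (S' U) 0)
    {n : ℕ} (h0 : ∃ φ₀, IsBootstrapFeasible r k S β (wordTruncation (ι := ι) r n) φ₀)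
    {P : C(ι → G, ℝ)} (hP : P ∈ certDomain r k S β n) :
    IsGreatest (feasibleValues r k S β n P)
      (gauge (certCone r k S β (wordTruncation (ι := ι) r n)) 1 P) := by
  obtain ⟨hKE, h1, hE⟩ := certCone_orderUnit r (k := k) (S := S) (β := β) n
  have h0' : ∃ φ₀, IsDualFeasible (certCone r k S β (wordTruncation (ι := ι) r n)) 1 φ₀ := by
    obtain ⟨φ₀, hφ₀⟩ := h0; exact ⟨φ₀, hφ₀.isDualFeasible r⟩
  have h := OrderUnitDuality.isGreatest_gauge (certDomain r k S β n) hKE h1 hE h0' hP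
  simp only [isDualFeasible_iff_feasible r hS] at h
  exact h

/-- ★★ **The SDP minimum is attained** (at `- gauge (-P)`). [folklore] -/
theorem exists_feasible_isLeast
    (hS : ∀ (i : ι) (a : K), ∃ S' ∈ polyAlgebra (ι := ι) r,
      ∀ U, HasDerivAt (fun t => S i (Function.update U i (k a t * U i))) (S' U) 0)
    {n : ℕ} (h0 : ∃ φ₀, IsBootstrapFeasible r k S β (wordTruncation (ι := ι) r n) φ₀)
    {P : C(ι → G, ℝ)} (hP : P ∈ certDomain r k S β n) :
    IsLeast (feasibleValues r k S β n P)
      (-gauge (certCone r k S β (wordTruncation (ι := ι) r n)) 1 (-P)) := by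
  have h := exists_feasible_isGreatest r hS h0 ((certDomain r k S β n).neg_mem hP)
  refine ⟨?_, fun t ht => ?_⟩
  · obtain ⟨φ, hφ, hφP⟩ := h.1
    refine ⟨φ, hφ, ?_⟩
    rw [← hφP, map_neg, neg_neg]
  · obtain ⟨φ, hφ, rfl⟩ := ht
    have h2 := h.2 ⟨φ, hφ, rfl⟩
    rw [map_neg] at h2
    linarith

/-- ★★ **The level-`n` feasible values of `P` form a compact interval `[lo, hi]`** (convexity of
feasibility + attained extrema). [folklore] -/
theorem exists_feasibleValues_eq_Icc
    (hS : ∀ (i : ι) (a : K), ∃ S' ∈ polyAlgebra (ι := ι) r,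
      ∀ U, HasDerivAt (fun t => S i (Function.update U i (k a t * U i))) (S' U) 0)
    {n : ℕ} (h0 : ∃ φ₀, IsBootstrapFeasible r k S β (wordTruncation (ι := ι) r n) φ₀)
    {P : C(ι → G, ℝ)} (hP : P ∈ certDomain r k S β n) :
    ∃ lo hi : ℝ, lo ≤ hi ∧ feasibleValues r k S β n P = Set.Icc lo hi := by
  have hG := exists_feasible_isGreatest r hS h0 hP
  have hL := exists_feasible_isLeast r hS h0 hP
  set hi := gauge (certCone r k S β (wordTruncation (ι := ι) r n)) 1 P
  set lo := -gauge (certCone r k S β (wordTruncation (ι := ι) r n)) 1 (-P)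
  obtain ⟨φ, hφ, hφP⟩ := hG.1
  obtain ⟨ψ, hψ, hψP⟩ := hL.1
  have hlohi : lo ≤ hi := hL.2 hG.1
  refine ⟨lo, hi, hlohi, Set.Subset.antisymm (fun t ht => ⟨hL.2 ht, hG.2 ht⟩) fun t ht => ?_⟩
  -- a convex combination of the minimiser and the maximiser takes every intermediate value
  rcases eq_or_lt_of_le hlohi with heq | hlt
  · refine ⟨φ, hφ, ?_⟩
    rw [hφP]
    exact le_antisymm (heq ▸ ht.1) ht.2
  · set a := (hi - t) / (hi - lo) with ha_def
    have hd : 0 < hi - lo := sub_pos.2 hlt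
    have ha : 0 ≤ a := div_nonneg (sub_nonneg.2 ht.2) hd.le
    have ha1 : a ≤ 1 := (div_le_one hd).2 (by linarith [ht.1])
    refine ⟨a • ψ + (1 - a) • φ, feasible_convex r hψ hφ ha (sub_nonneg.2 ha1) (by ring), ?_⟩
    simp only [LinearMap.add_apply, LinearMap.smul_apply, smul_eq_mul, hφP, hψP]
    rw [ha_def]
    field_simp
    ring

/-- ★★ **No duality gap, as an equation**: the level-`n` SDP maximum of `P` equals the infimum of
the certified upper bounds, `max (feasibleValues P) = inf {c | c • 1 - P ∈ certCone}`. [folklore] -/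
theorem sSup_feasibleValues_eq_sInf
    (hS : ∀ (i : ι) (a : K), ∃ S' ∈ polyAlgebra (ι := ι) r,
      ∀ U, HasDerivAt (fun t => S i (Function.update U i (k a t * U i))) (S' U) 0)
    {n : ℕ} (h0 : ∃ φ₀, IsBootstrapFeasible r k S β (wordTruncation (ι := ι) r n) φ₀)
    {P : C(ι → G, ℝ)} (hP : P ∈ certDomain r k S β n) :
    sSup (feasibleValues r k S β n P) =
      sInf {c : ℝ | c • (1 : C(ι → G, ℝ)) - P ∈ certCone r k S β (wordTruncation (ι := ι) r n)} :=
  (exists_feasible_isGreatest r hS h0 hP).csSup_eq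

/-- ★★ **The certified upper bounds are exactly the constants above the maximum** (up to the
endpoint): `(max, ∞) ⊆ {c | c • 1 - P ∈ certCone} ⊆ [max, ∞)`. [folklore] -/
theorem Ioi_subset_certified_subset_Ici
    (hS : ∀ (i : ι) (a : K), ∃ S' ∈ polyAlgebra (ι := ι) r,
      ∀ U, HasDerivAt (fun t => S i (Function.update U i (k a t * U i))) (S' U) 0)
    {n : ℕ} (h0 : ∃ φ₀, IsBootstrapFeasible r k S β (wordTruncation (ι := ι) r n) φ₀)
    {P : C(ι → G, ℝ)} (hP : P ∈ certDomain r k S β n) :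
    Set.Ioi (sSup (feasibleValues r k S β n P)) ⊆
        {c : ℝ | c • (1 : C(ι → G, ℝ)) - P ∈ certCone r k S β (wordTruncation (ι := ι) r n)} ∧
      {c : ℝ | c • (1 : C(ι → G, ℝ)) - P ∈ certCone r k S β (wordTruncation (ι := ι) r n)} ⊆
        Set.Ici (sSup (feasibleValues r k S β n P)) := by
  obtain ⟨-, h1, hE⟩ := certCone_orderUnit r (k := k) (S := S) (β := β) n
  have h0' : ∃ φ₀, IsDualFeasible (certCone r k S β (wordTruncation (ι := ι) r n)) 1 φ₀ := by
    obtain ⟨φ₀, hφ₀⟩ := h0; exact ⟨φ₀, hφ₀.isDualFeasible r⟩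
  rw [(exists_feasible_isGreatest r hS h0 hP).csSup_eq]
  exact OrderUnitDuality.Ioi_subset_certLevels (certDomain r k S β n) h1 hE h0' hP

end General

end Summit.QuantumFields.GaugeBoot

end
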